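import Summits.NavierStokesRegularity.FluidComputer.PalasekTowerFaceLayerAt

/-!
# REGISTER v2.3′ AT ARBITRARY RATES, III: the R-generic face layer, part II — the continuation-principle splits at
# `(R, k)`: `ContinuationEnvelopeGAt R k ↔ AprioriCeilingGAt R k ↔ NoPrematureBreakdownGAt R k ∧ WindowCeilingGAt R k`
# (`k ≥ 1`), `HeredityOrBreakdownGAt R k ↔ WindowCeilingGAt R k ∧ ReadoutFloorsGAt R k`, and the five-face form of
# `HeredityAtGAt R k`

Cell `ns-blowup`, seat `ns-blowup-fc-prover-2` (g9; typing ask of the PTB tenure planner g23, STATUS 2026-08-27T10:55Z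
(iii), GO 11:06Z). Companion of `PalasekTowerFaceLayerAt.lean` (part I: the twelve `…GAt R k` faces, `wide ↔`, logical
layer). LABEL: E–C typing (KERNEL glue; no `Prop` introduced here). WHAT THIS IS NOT: not Navier–Stokes evidence —
verbatim ports at `(R, k)` of `continuationEnvelopeAt_of_local_apriori` / `continuationEnvelopeAt_iff_aprioriCeilingAt`
(`PalasekTowerRegisterGlobalEnvelopeAt{,Holds}.lean`), `aprioriCeilingAt_iff_noPrematureBreakdown_and_windowCeiling` and
`heredityOrBreakdownAt_iff_windowCeiling_and_readoutFloorsAt` (`PalasekTowerHeredityOrBreakdownAt.lean`); every helper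
(`Stage.velocity_eq_of_classical`, `Stage.exists_pressure_regauge`, `Stage.exists_extends_of_continuation`,
`Stage.exists_glue_translated`, `Stage.exists_forced_continuation` with `tao2011_smooth_local_existence_forced_holds`,
`velocity_eq_of_bounded_classical`, `exists_classical_extension_Icc_of_apriori_bound`) is generic in the rates already;
nothing is inhabited or asserted, no item filed or re-worded.

References: S. Palasek, arXiv:2605.13827 §4 [cite: Palasek2026ElementaryModel, §4]; H. Sohr, *The Navier–Stokes
Equations*, Birkhäuser 2001, Ch. V Thm. 1.5.1 [cite: Sohr2001, Ch. V Thm. 1.5.1]; J. C. Robinson, J. L. Rodrigo,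
W. Sadowski, CUP 2016, Thm. 8.17 [cite: RobinsonRodrigoSadowski2016, Thm. 8.17]; T. Tao, Anal. PDE 6 (2013), Thm. 5.4
[cite: Tao2011, Thm. 5.4 (ii)+(iv)].
-/

noncomputable section

namespace Summit.NavierStokesRegularity.FluidComputer.PalasekTowerClayBridge

open Set MeasureTheory Filter Topology Function Real
open scoped ENNReal ContDiff NNReal
open Literature.Analysis.FluidPDE
open Summit.NavierStokesRegularity.NavierStokesRegularity

variable {R : TowerRates}

/-! ## §1 The continuation-principle layer at `(R, k)`: the upper half is the no-overshoot bet -/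

/-- **`LocalContinuationGAt R k` HOLDS at every `(R, k)`** (Tao's forced local theory, discharged in the tree:
`Stage.exists_forced_continuation` with `tao2011_smooth_local_existence_forced_holds`). [cite: Tao2011, Thm. 5.4 (ii)+(iv)] -/
theorem localContinuationGAt_holds (R : TowerRates) (k : ℕ) : LocalContinuationGAt R k :=
  fun _ _ _ _ s => Stage.exists_forced_continuation tao2011_smooth_local_existence_forced_holds one_pos s

/-- The upper half gives the local continuation. [folklore] -/
theorem ContinuationEnvelopeGAt.localContinuation {k : ℕ} (h : ContinuationEnvelopeGAt R k) :
    LocalContinuationGAt R k := by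
  intro S hP hR hQ s
  obtain ⟨u, p, hcl, hagree, henergy, -⟩ := h S hP hR hQ s
  exact ⟨S.τ (k + 1), S.τ_lt_succ k, u, p, hcl, hagree, henergy⟩

/-- **The upper half gives the a-priori ceiling**: a finite-energy classical continuation on `[0, T']`,
`T' ≤ τ (k+1)`, coincides there with the envelope's bounded continuation (forced Serrin–Masuda,
`velocity_eq_of_bounded_classical`), hence is inside the ceiling. [cite: Sohr2001, Ch. V Thm. 1.5.1] -/
theorem ContinuationEnvelopeGAt.aprioriCeiling {k : ℕ} (h : ContinuationEnvelopeGAt R k) :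
    AprioriCeilingGAt R k := by
  intro S hP hR hQ s T' hT' u p hcl hagree henergy t ht x
  obtain ⟨u₁, p₁, hcl₁, hagree₁, henergy₁, hceil₁⟩ := h S hP hR hQ s
  have hT'0 : 0 < T' := (S.τ_pos k).trans_le hT'.1
  have hcl₁' : IsClassicalNSSolutionOn (Icc 0 T') 1 S.f u₁ p₁ :=
    hcl₁.mono (Icc_subset_Icc le_rfl hT'.2) (uniqueDiffOn_Icc hT'0)
  have henergy₁' : ∃ C : ℝ≥0∞, C < ⊤ ∧ ∀ t ∈ Icc 0 T', ∫⁻ x, ‖u₁ t x‖ₑ ^ 2 ≤ C := by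
    obtain ⟨C, hC, hb⟩ := henergy₁
    exact ⟨C, hC, fun t ht => hb t ⟨ht.1, ht.2.trans hT'.2⟩⟩
  have hB : ∀ t ∈ Icc 0 T', ∀ x, ‖u₁ t x‖ ≤ S.c₂ * R.Y (k + 1) :=
    fun t ht x => hceil₁ t ⟨ht.1, ht.2.trans hT'.2⟩ x
  have h0 : (0 : ℝ) ∈ Icc 0 (S.τ k) := ⟨le_rfl, (S.τ_pos k).le⟩
  have h00 : u 0 = u₁ 0 := by rw [(hagree 0 h0).1, (hagree₁ 0 h0).1]
  have heq : ∀ t ∈ Icc 0 T', u t = u₁ t :=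
    velocity_eq_of_bounded_classical one_pos hT'0 S.force_smooth S.force_decay hcl₁' henergy₁' hB
      hcl henergy h00
  rw [heq t ht]
  exact hB t ht x

/-- **THE UPPER HALF FROM ITS TWO STUBS at `(R, k)`, `k ≥ 1`** (verbatim port of
`continuationEnvelopeAt_of_local_apriori`: translate the local continuation to the origin `τ k`, continue the
unforced translate a priori to `[0, τ (k+1) − τ k]` by `exists_classical_extension_Icc_of_apriori_bound`, glue
back by `Stage.exists_glue_translated`). [cite: RobinsonRodrigoSadowski2016, Thm. 8.17] -/
theorem continuationEnvelopeGAt_of_local_apriori {k : ℕ} (hk : 1 ≤ k) (hL : LocalContinuationGAt R k)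
    (hA : AprioriCeilingGAt R k) : ContinuationEnvelopeGAt R k := by
  intro S hP hR hQ s
  obtain ⟨T', hT', u₁, p₁, hcl₁, hagree₁, henergy₁⟩ := hL S hP hR hQ s
  set τk : ℝ := S.τ k with hτk
  set L₁ : ℝ := S.τ (k + 1) - τk with hL₁
  have hτk0 : 0 < τk := S.τ_pos k
  have hL₁0 : 0 < L₁ := by rw [hL₁]; linarith [S.τ_lt_succ k]
  have h1k : S.τ 1 ≤ τk := S.τ_mono hk
  -- the local continuation, cut to `[0, τ k + δ]` with `0 < δ ≤ L₁`
  set δ : ℝ := min (T' - τk) L₁ with hδ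
  have hδ0 : 0 < δ := lt_min (by linarith) hL₁0
  have hδL : δ ≤ L₁ := min_le_right _ _
  have hδT : τk + δ ≤ T' := by have := min_le_left (T' - τk) L₁; rw [← hδ] at this; linarith
  have hcl₁' : IsClassicalNSSolutionOn (Icc 0 (τk + δ)) 1 S.f u₁ p₁ :=
    hcl₁.mono (Icc_subset_Icc le_rfl hδT) (uniqueDiffOn_Icc (by linarith))
  have henergy₁' : ∃ C : ℝ≥0∞, C < ⊤ ∧ ∀ t ∈ Icc 0 (τk + δ), ∫⁻ x, ‖u₁ t x‖ₑ ^ 2 ≤ C := by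
    obtain ⟨C, hC, hb⟩ := henergy₁
    exact ⟨C, hC, fun t ht => hb t ⟨ht.1, ht.2.trans hδT⟩⟩
  -- its translate to the origin `τ k`: unforced, classical on `[0, δ]`, finite energy
  have htr : IsClassicalNSSolutionOn (Icc 0 (τk + δ - τk)) 1 0 (fun t => u₁ (t + τk))
      (fun t => p₁ (t + τk)) :=
    isClassicalNSSolutionOn_translate_of_silent hcl₁' hτk0.le (by linarith) (fun t ht => hQ t (h1k.trans ht))
  have eδ : τk + δ - τk = δ := by ring
  rw [eδ] at htr
  have hEtr : ∃ A : ℝ≥0∞, A < ⊤ ∧ ∀ t ∈ Icc 0 δ, ∫⁻ x, ‖u₁ (t + τk) x‖ₑ ^ 2 ≤ A := by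
    obtain ⟨C, hC, hb⟩ := henergy₁'
    exact ⟨C, hC, fun t ht => hb (t + τk) ⟨by linarith [ht.1], by linarith [ht.2]⟩⟩
  -- every unforced finite-energy continuation of the translate up to `L₁` is inside the ceiling
  have hM : ∀ T'' ∈ Icc δ L₁,
      ∀ (w : ℝ → EuclideanSpace ℝ (Fin 3) → EuclideanSpace ℝ (Fin 3))
        (r : ℝ → EuclideanSpace ℝ (Fin 3) → ℝ),
        IsClassicalNSSolutionOn (Icc 0 T'') 1 0 w r →
        (∀ t ∈ Icc 0 δ, w t = u₁ (t + τk) ∧ r t = p₁ (t + τk)) →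
        (∃ A : ℝ≥0∞, A < ⊤ ∧ ∀ t ∈ Icc 0 T'', ∫⁻ x, ‖w t x‖ₑ ^ 2 ≤ A) →
        ∀ t ∈ Icc 0 T'', ∀ x, ‖w t x‖ ≤ S.c₂ * R.Y (k + 1) := by
    intro T'' hT'' w r hw hw₁ hEw t ht x
    obtain ⟨u, p, hcl, hagree, henergy, htrw⟩ :=
      s.exists_glue_translated hQ hk hδ0 hT''.1 hcl₁' hagree₁ henergy₁' hw hw₁ hEw
    have hslab : τk + T'' ∈ Icc (S.τ k) (S.τ (k + 1)) :=
      ⟨by linarith [hT''.1], by rw [hL₁] at hT''; linarith [hT''.2]⟩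
    have hb := hA S hP hR hQ s (τk + T'') hslab u p hcl hagree henergy (t + τk)
      ⟨by linarith [ht.1], by linarith [ht.2]⟩ x
    rwa [htrw t ht] at hb
  -- a-priori continuation of the translate to `[0, L₁]`
  obtain ⟨w, r, hw, hw₁, hEw, -⟩ :=
    exists_classical_extension_Icc_of_apriori_bound one_pos hδ0 hδL htr hEtr hM
  -- glue back: a continuation of the stage to `τ (k+1)`
  obtain ⟨u, p, hcl, hagree, henergy, -⟩ :=
    s.exists_glue_translated hQ hk hδ0 hδL hcl₁' hagree₁ henergy₁' hw hw₁ hEw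
  have eL : τk + L₁ = S.τ (k + 1) := by rw [hL₁]; ring
  rw [eL] at hcl henergy
  refine ⟨u, p, hcl, hagree, henergy, ?_⟩
  exact hA S hP hR hQ s (S.τ (k + 1)) ⟨S.τ_mono (Nat.le_succ k), le_rfl⟩ u p hcl hagree henergy

/-- **`ContinuationEnvelopeGAt R k ↔ AprioriCeilingGAt R k` for every `k ≥ 1`, no hypothesis** (the local continuation
holds, `localContinuationGAt_holds`). [cite: RobinsonRodrigoSadowski2016, Thm. 8.17] -/
theorem continuationEnvelopeGAt_iff_aprioriCeilingGAt {k : ℕ} (hk : 1 ≤ k) :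
    ContinuationEnvelopeGAt R k ↔ AprioriCeilingGAt R k :=
  ⟨fun h => h.aprioriCeiling,
    fun h => continuationEnvelopeGAt_of_local_apriori hk (localContinuationGAt_holds R k) h⟩

/-- **The a-priori ceiling at `(R, k)`, `k ≥ 1`, contains «no premature breakdown»**: given the ceiling, the stage's
flow continues classically with finite energy to `τ (k+1)` (`continuationEnvelopeGAt_iff_aprioriCeilingGAt`), a life of
the design. [cite: RobinsonRodrigoSadowski2016, Thm. 8.17] -/
theorem AprioriCeilingGAt.noPrematureBreakdown {k : ℕ} (hk : 1 ≤ k) (h : AprioriCeilingGAt R k) :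
    NoPrematureBreakdownGAt R k := by
  rintro S hP hR hQ ⟨s⟩
  obtain ⟨u, p, hcl, hagree, hE, -⟩ := (continuationEnvelopeGAt_iff_aprioriCeilingGAt hk).2 h S hP hR hQ s
  exact ⟨u, p, hcl, ((hagree 0 ⟨le_rfl, (S.τ_pos k).le⟩).1).trans s.initial, hE⟩

/-- The a-priori ceiling at `(R, k)` yields the window ceiling (re-gauge the survivor's pressure to the stage's,
`Stage.exists_pressure_regauge`, then read the ceiling at `T' = τ (k+1)`). [cite: Sohr2001, Ch. V Thm. 1.5.1] -/
theorem AprioriCeilingGAt.windowCeiling {k : ℕ} (h : AprioriCeilingGAt R k) : WindowCeilingGAt R k := by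
  intro S hP hR hQ s v q hcl hv0 hE t ht x
  have hτle : S.τ k ≤ S.τ (k + 1) := S.τ_mono (Nat.le_succ k)
  have hvel : ∀ t ∈ Icc 0 (S.τ k), v t = s.u t := s.velocity_eq_of_classical one_pos hτle hcl hv0 hE
  obtain ⟨P, hclP, hagree⟩ := s.exists_pressure_regauge hτle hcl hvel
  exact h S hP hR hQ s (S.τ (k + 1)) ⟨hτle, le_rfl⟩ v P hclP hagree hE t ⟨(S.τ_pos k).le.trans ht.1, ht.2⟩ x

/-- **`AprioriCeilingGAt R k ↔ NoPrematureBreakdownGAt R k ∧ WindowCeilingGAt R k`** for every `k ≥ 1`. (←): a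
partial continuation coincides with the surviving datum flow on its slab (forced Serrin–Masuda, the survivor being
bounded by the stage ceiling before `τ k` and by the window ceiling after). [cite: Sohr2001, Ch. V Thm. 1.5.1] -/
theorem aprioriCeilingGAt_iff_noPrematureBreakdown_and_windowCeiling {k : ℕ} (hk : 1 ≤ k) :
    AprioriCeilingGAt R k ↔ NoPrematureBreakdownGAt R k ∧ WindowCeilingGAt R k := by
  refine ⟨fun h => ⟨h.noPrematureBreakdown hk, h.windowCeiling⟩, fun ⟨hN, hW⟩ => ?_⟩
  intro S hP hR hQ s T' hT' u p hcl hagree hE t ht x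
  have hτk : 0 < S.τ k := S.τ_pos k
  have hτle : S.τ k ≤ S.τ (k + 1) := S.τ_mono (Nat.le_succ k)
  have hT'0 : 0 < T' := hτk.trans_le hT'.1
  obtain ⟨v, q, hclv, hv0, hEv⟩ := hN S hP hR hQ ⟨s⟩
  have hvel : ∀ t ∈ Icc 0 (S.τ k), v t = s.u t := s.velocity_eq_of_classical one_pos hτle hclv hv0 hEv
  have hB : ∀ t ∈ Icc 0 (S.τ (k + 1)), ∀ x, ‖v t x‖ ≤ S.c₂ * R.Y (k + 1) := by
    intro t ht x
    rcases le_or_gt t (S.τ k) with htk | htk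
    · rw [hvel t ⟨ht.1, htk⟩]
      exact (s.ceiling k le_rfl t ⟨ht.1, htk⟩ x).trans
        (mul_le_mul_of_nonneg_left (R.Y_le_Y_succ k) s.c₂_pos.le)
    · exact hW S hP hR hQ s v q hclv hv0 hEv t ⟨htk.le, ht.2⟩ x
  have hclv' : IsClassicalNSSolutionOn (Icc 0 T') 1 S.f v q :=
    hclv.mono (Icc_subset_Icc le_rfl hT'.2) (uniqueDiffOn_Icc hT'0)
  have hEv' : ∃ C : ℝ≥0∞, C < ⊤ ∧ ∀ t ∈ Icc 0 T', ∫⁻ x, ‖v t x‖ₑ ^ 2 ≤ C := by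
    obtain ⟨C, hC, hb⟩ := hEv
    exact ⟨C, hC, fun t ht => hb t ⟨ht.1, ht.2.trans hT'.2⟩⟩
  have h0 : u 0 = v 0 := by rw [(hagree 0 ⟨le_rfl, hτk.le⟩).1, s.initial, hv0]
  have huv : ∀ t ∈ Icc 0 T', u t = v t :=
    velocity_eq_of_bounded_classical one_pos hT'0 S.force_smooth S.force_decay hclv' hEv'
      (fun t ht => hB t ⟨ht.1, ht.2.trans hT'.2⟩) hcl hE h0
  rw [huv t ht]
  exact hB t ⟨ht.1, ht.2.trans hT'.2⟩ x

/-! ## §2 The weak heredity at `(R, k)` in the register's halves -/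

/-- The weak heredity at `(R, k)` yields the readout floors (the continued flow IS the extension's velocity; its
floors at `τ (k+1)` are the extension's). [cite: Sohr2001, Ch. V Thm. 1.5.1] -/
theorem HeredityOrBreakdownGAt.readoutFloors {k : ℕ} (h : HeredityOrBreakdownGAt R k) : ReadoutFloorsGAt R k := by
  intro S hP hR hQ s u p hcl hagree hE _hceil
  have hu0 : u 0 = S.u₀ := ((hagree 0 ⟨le_rfl, (S.τ_pos k).le⟩).1).trans s.initial
  rcases h S hP hR hQ s with hdead | ⟨s', -⟩
  · exact absurd ⟨u, p, hcl, hu0, hE⟩ hdead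
  · have hτ : S.τ (k + 1) ∈ Icc 0 (S.τ (k + 1)) := ⟨(S.τ_pos (k + 1)).le, le_rfl⟩
    rw [s'.velocity_eq_of_classical one_pos le_rfl hcl hu0 hE _ hτ]
    exact ⟨s'.floor (k + 1) le_rfl, s'.routeG_strain (k + 1) le_rfl, s'.routeG_coreLedger (k + 1) le_rfl⟩

/-- **`HeredityOrBreakdownGAt R k ↔ WindowCeilingGAt R k ∧ ReadoutFloorsGAt R k`** (any `k`): (←) the survivor's flow,
re-gauged to the stage's pressure (`Stage.exists_pressure_regauge`), stays inside the ceiling (stage ceiling before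
`τ k`, window ceiling after), shows the floors by `ReadoutFloorsGAt R k`, and `Stage.exists_extends_of_continuation`
assembles the level-`k+1` stage. [cite: Palasek2026ElementaryModel, §4] -/
theorem heredityOrBreakdownGAt_iff_windowCeiling_and_readoutFloors (k : ℕ) :
    HeredityOrBreakdownGAt R k ↔ WindowCeilingGAt R k ∧ ReadoutFloorsGAt R k := by
  refine ⟨fun h => ⟨h.windowCeiling, h.readoutFloors⟩, fun ⟨hW, hF⟩ S hP hR hQ s => ?_⟩
  by_cases hlive : S.LivesTo 1 (S.τ (k + 1))
  · refine Or.inr ?_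
    obtain ⟨v, q, hcl, hv0, hE⟩ := hlive
    have hτle : S.τ k ≤ S.τ (k + 1) := S.τ_mono (Nat.le_succ k)
    have hvel : ∀ t ∈ Icc 0 (S.τ k), v t = s.u t := s.velocity_eq_of_classical one_pos hτle hcl hv0 hE
    obtain ⟨P, hclP, hagree⟩ := s.exists_pressure_regauge hτle hcl hvel
    have hceil : ∀ t ∈ Icc 0 (S.τ (k + 1)), ∀ x, ‖v t x‖ ≤ S.c₂ * R.Y (k + 1) := by
      intro t ht x
      rcases le_or_gt t (S.τ k) with htk | htk
      · rw [hvel t ⟨ht.1, htk⟩]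
        exact (s.ceiling k le_rfl t ⟨ht.1, htk⟩ x).trans
          (mul_le_mul_of_nonneg_left (R.Y_le_Y_succ k) s.c₂_pos.le)
      · exact hW S hP hR hQ s v q hcl hv0 hE t ⟨htk.le, ht.2⟩ x
    obtain ⟨hfloor, hstrain, hcore⟩ := hF S hP hR hQ s v P hclP hagree hE hceil
    exact s.exists_extends_of_continuation hR hclP hagree hE hceil hfloor hstrain hcore
  · exact Or.inl hlive

/-- The three-floor form: `HeredityOrBreakdownGAt R k ↔ WindowCeilingGAt R k ∧ SpeedFloorGAt R k ∧ StrainFloorGAt R k ∧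
CoreFloorGAt R k`. [folklore] -/
theorem heredityOrBreakdownGAt_iff_windowCeiling_floors3 (k : ℕ) :
    HeredityOrBreakdownGAt R k ↔
      WindowCeilingGAt R k ∧ SpeedFloorGAt R k ∧ StrainFloorGAt R k ∧ CoreFloorGAt R k := by
  rw [heredityOrBreakdownGAt_iff_windowCeiling_and_readoutFloors, readoutFloorsGAt_iff_floors]

/-- **The register's heredity at `(R, k)` as clause × window ceiling × floors**:
`HeredityAtGAt R k ↔ NoPrematureBreakdownGAt R k ∧ WindowCeilingGAt R k ∧ ReadoutFloorsGAt R k`. [folklore] -/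
theorem heredityAtGAt_iff_noPrematureBreakdown_windowCeiling_readoutFloors (k : ℕ) :
    HeredityAtGAt R k ↔ NoPrematureBreakdownGAt R k ∧ WindowCeilingGAt R k ∧ ReadoutFloorsGAt R k := by
  rw [heredityAtGAt_iff_orBreakdown_and_noPrematureBreakdown,
    heredityOrBreakdownGAt_iff_windowCeiling_and_readoutFloors]
  exact ⟨fun ⟨⟨hW, hF⟩, hN⟩ => ⟨hN, hW, hF⟩, fun ⟨hN, hW, hF⟩ => ⟨⟨hW, hF⟩, hN⟩⟩

/-- **The FIVE-FACE form at `(R, k)`**: `HeredityAtGAt R k ↔ NoPrematureBreakdownGAt R k ∧ WindowCeilingGAt R k ∧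
SpeedFloorGAt R k ∧ StrainFloorGAt R k ∧ CoreFloorGAt R k` — the cut of the wide birth skeletons of 19249/19250, now
available at any rates (at `R = tuned`, `k = 1`: item 20304 `HeredityAtOneT`). [folklore] -/
theorem heredityAtGAt_iff_noPrematureBreakdown_windowCeiling_floors3 (k : ℕ) :
    HeredityAtGAt R k ↔ NoPrematureBreakdownGAt R k ∧ WindowCeilingGAt R k ∧
      SpeedFloorGAt R k ∧ StrainFloorGAt R k ∧ CoreFloorGAt R k := by
  rw [heredityAtGAt_iff_noPrematureBreakdown_windowCeiling_readoutFloors, readoutFloorsGAt_iff_floors]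

/-- Heredity at `(R, k)` from its five faces (the composition a five-stub line on `HeredityAtGAt R k` registers).
[folklore] -/
theorem heredityAtGAt_of_faces {k : ℕ} (hN : NoPrematureBreakdownGAt R k) (hW : WindowCeilingGAt R k)
    (h₁ : SpeedFloorGAt R k) (h₂ : StrainFloorGAt R k) (h₃ : CoreFloorGAt R k) : HeredityAtGAt R k :=
  (heredityAtGAt_iff_noPrematureBreakdown_windowCeiling_floors3 k).2 ⟨hN, hW, h₁, h₂, h₃⟩

/-- **The register's heredity at `(R, k)`, `k ≥ 1`, in its two halves**: `HeredityAtGAt R k ↔ ContinuationEnvelopeGAt R k ∧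
ReadoutFloorsGAt R k` (through `continuationEnvelopeGAt_iff_aprioriCeilingGAt` and the two splits above).
[cite: Palasek2026ElementaryModel, §4] -/
theorem heredityAtGAt_iff_envelope_and_floors {k : ℕ} (hk : 1 ≤ k) :
    HeredityAtGAt R k ↔ ContinuationEnvelopeGAt R k ∧ ReadoutFloorsGAt R k := by
  rw [heredityAtGAt_iff_noPrematureBreakdown_windowCeiling_readoutFloors,
    continuationEnvelopeGAt_iff_aprioriCeilingGAt hk, aprioriCeilingGAt_iff_noPrematureBreakdown_and_windowCeiling hk,
    and_assoc]

/-- `HeredityAtGAt R k ↔ AprioriCeilingGAt R k ∧ ReadoutFloorsGAt R k` for `k ≥ 1` (the two registered halves of the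
wide birth line of 19249, at any rates). [cite: Palasek2026ElementaryModel, §4] -/
theorem heredityAtGAt_iff_apriori_and_floors {k : ℕ} (hk : 1 ≤ k) :
    HeredityAtGAt R k ↔ AprioriCeilingGAt R k ∧ ReadoutFloorsGAt R k := by
  rw [heredityAtGAt_iff_envelope_and_floors hk, continuationEnvelopeGAt_iff_aprioriCeilingGAt hk]

/-- Heredity FROM `k₀ ≥ 1` at `R` from the faces at every level `k ≥ k₀`. [folklore] -/
theorem heredityFromGAt_of_faces {k₀ : ℕ}
    (hN : ∀ k, k₀ ≤ k → NoPrematureBreakdownGAt R k) (hW : ∀ k, k₀ ≤ k → WindowCeilingGAt R k)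
    (hF : ∀ k, k₀ ≤ k → ReadoutFloorsGAt R k) : HeredityFromGAt R k₀ :=
  fun S hP hR hQ k hk s =>
    (heredityAtGAt_iff_noPrematureBreakdown_windowCeiling_readoutFloors k).2 ⟨hN k hk, hW k hk, hF k hk⟩ S hP hR hQ s

end Summit.NavierStokesRegularity.FluidComputer.PalasekTowerClayBridge

end
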